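import Literature.MathematicalPhysics.QuantumFieldTheory.Balaban1983to89.B9B8KnitTorusSocketOfDeltaASide

/-!
# `Balaban1983to89.B9B8KnitTorusSocketThreshold` — T. Bałaban, *Propagators and renormalization transformations for lattice gauge theories. I*, Commun.
# Math. Phys. **95** (1984) 17–40 [Balaban1985RegularSpaces], p. 86 (the weights `|·|₍α₎` after (1.55)), (1.56), (1.58)–(1.60) pp. 86–87, Prop. 3 p. 87;
# *Propagators for lattice gauge theories in a background field*, CMP **99** (1985) 389–434 [Balaban1985BackgroundPropagators], (3.16)–(3.17) p. 393 (the
# weights of `Q*`), (3.41) p. 397 (the weighted norms), (3.69) p. 404 («O(1)(Mα₀ + α₁)»): **THE THRESHOLD ARITHMETIC OF THE TORUS SOCKET — `κ(a_T)` AND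
# `ε_Q(a_T)` ARE MEMBER-UNIFORM MULTIPLES OF `a_T`** — the (B)-line bond junction, file F7 (over F6 `B9B8KnitTorusSocketOfDeltaASide`).

statement-level skeleton of published theorems with citation tags; proofs where landed; nothing here is a claim about the Yang–Mills mass gap

THE POINT.  F6 reduced pub-ymgap's guarded periodic socket `SockB9P3Per … 0 len η n ℤ^{d+1} torusLam torusLamb` at a torus member to the Δ_a-side members
plus ONE numeric condition `2(κ(a_T) + 14d·M·a_T + ε_Q(a_T))·B₀ ≤ 1`, where `κ(a_T)` (F5) and `ε_Q(a_T)` (F4) carry the member's weight ratio `w₋₃∕w₋₁`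
(`w_β = (Lⁿ|c_f|⁻¹)^{−β}`), `c_f²·L^{−2n}`, `(c_fη)²` and the level weight `w_n = (Lⁿη)⁻³L^{nd}` of `Q*aQ`.  The [B8] Thm 2 torus assembler
(`B8Thm2T3FamilyBinderSockPer.hThm2_of_core_sockPer`) consumes the socket for EVERY member `m′ ≤ K − n` at ONE radius — so the condition must be met by one
`a_T` for all members.  It is: `w₋₃∕w₋₁ = L^{2n}c_f⁻²` exactly (`weight_ratio_eq`, any `c_f ≠ 0`), whence `κ(a_T) = 48(d+1)·a_T` (`kappa_eq`) and
`ε_Q(a_T) = (32(d+2)² + 12(d+1)²·K₁·C_τβ_τ)·a_T` EXACTLY (`epsQ_eq`, `K₁ = 13344(d+1)(d+2)²(d+5)L^{d+4}`; every power of `Lⁿ` and of `η` cancels) — print's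
«O(1)(Mα₀ + α₁)» with the `O(1)` a pure number depending on `d`, `L` and the trace datum only.

WHAT THIS FILE PROVES (all `theorem`s; 0 `def`, 0 new named facts, 0 `sorry`; standard axioms).
* §1 ★ `weight_ratio_eq`, ★ `kappa_eq`, ★ `epsQ_eq` (real arithmetic over `B8ScaledSupNorm.weight_neg_natCast` and the definition of
  `B9Eq316AveragingTransposeZd.wQ`).
* §2 ★★★ `sockB9P3Per_torusIdx_of_deltaASide_unif` — F6's `sockB9P3Per_torusIdx_of_deltaASide` (fibre `M_N(ℂ)`, `τ = tr`, `parB = parBY i`) with the numeric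
  condition replaced by the MEMBER-UNIFORM one `2·(48(d+1) + 14d·M + 32(d+2)² + 12(d+1)²·K₁·C_τβ_τ)·a_T·B₀ ≤ 1` (no `n`, `η`, `c_f`): one threshold `a_T`
  serves every member of the assembler's socket hypothesis, given the Δ_a-side members at a member-uniform `B₀`.

HONEST FRAMING.  Arithmetic only; the Δ_a-side members (def-Y's Thm 3.3 ∕ 3.11 ∕ Cor 3.6 data at the knit's letters, G-B9-LETTERS road) and the uniformity
of THEIR constant `B₀` over members remain displayed; nothing of NODE 00's, file 8c's, F4–F6's or the lane's files is modified; `stub_PV3A` NOT discharged;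
counts unmoved; one finite 𝕋⁴ programme at fixed ε, Bałaban AS PRINTED; the YM mass gap (Clay) is NOT proved by any of this — nothing continuum ∕ ℝ⁴ ∕ OS.
Cell `lit-balaban`, seat t2s-1 g8 («B8 §3 Thm 2 TORUS SUPPLIER», (B)-line bond junction); `--supports stmt-QuantumFields-19200`.

References: T. Bałaban, CMP 95 (1984) 17–40 [Balaban1985RegularSpaces] p.86, (1.56), (1.58)–(1.60) pp.86–87, Prop. 3 p.87; CMP 99 (1985) 389–434
[Balaban1985BackgroundPropagators] (3.16)–(3.17) p.393, (3.41) p.397, Thm 3.3 p.399, (3.69) p.404, Thm 3.11 p.416.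
-/

noncomputable section

namespace Literature.MathematicalPhysics.QuantumFieldTheory.Balaban1983to89.B9B8KnitTorusSocketThreshold

open scoped BigOperators
open Node00
open B7Prop1Explicit renaming Site → LSite
open B7Prop2Explicit (unitaryUnits C0 c2')
open B6KLevelCensusIndexV1 (KIdx)
open B6GlobalChartV1 (PV)
open B8Ineq132 (InAk)
open B8LeafModelZd (ZdIdx)
open B8LeafModelZd3SockPer (SockB9P3Per)
open B8Thm4TorusAt (torusLam)
open B8Thm2TorusMember (TorusMember torusIdx torusLamb)
open B8ScaledSupNorm (weight weight_neg_natCast)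
open B9B8AveragingJunction (parKnitY)
open B8Thm2TorusLettersPerOfKnit (bgY)
open B9SupplySockB9P3ZdLetters (OpsZd)
open B9Eq316AveragingTransposeZd (qQ betaTau wQ alphaQ)
open B9B8KnitTorusSocketOfDeltaASide (sockB9P3Per_torusIdx_of_deltaASide)
open T4TermwiseTorus (IsPeriodic)

variable {d ℓ : ℕ} {hd : 1 ≤ d + 1} {hL : Odd (ℓ + 1) ∧ 1 < ℓ + 1} {b₀ b₁ : ℝ}

/-! ## §1 The weight ratio and the two threshold constants as pure numbers -/

section Arithmetic

variable (i : KIdx d ℓ hd hL b₀ b₁) (n : ℕ)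

/-- ★ **THE WEIGHT RATIO**: `w₋₃∕w₋₁ = (Lⁿ|c_f|⁻¹)² = L^{2n}·c_f⁻²` (`w_β = (Lⁿ|c_f|⁻¹)^{−β}`). [cite: Balaban1985RegularSpaces, p.86 (definition after (1.55)); Balaban1985BackgroundPropagators, (3.41) p.397] -/
theorem weight_ratio_eq :
    weight (ℓ + 1) |i.cf|⁻¹ (-3) n / weight (ℓ + 1) |i.cf|⁻¹ (-1) n = ((((ℓ + 1 : ℕ) : ℝ)) ^ n) ^ 2 * (i.cf ^ 2)⁻¹ := by
  have h3 : weight (ℓ + 1) |i.cf|⁻¹ (-3) n = ((((ℓ + 1 : ℕ) : ℝ)) ^ n * |i.cf|⁻¹) ^ 3 := by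
    rw [show (-3 : ℝ) = -((3 : ℕ) : ℝ) by norm_num, weight_neg_natCast]
  have h1 : weight (ℓ + 1) |i.cf|⁻¹ (-1) n = ((((ℓ + 1 : ℕ) : ℝ)) ^ n * |i.cf|⁻¹) ^ 1 := by
    rw [show (-1 : ℝ) = -((1 : ℕ) : ℝ) by norm_num, weight_neg_natCast]
  have hcf : i.cf ≠ 0 := i.hcf
  have hacf : |i.cf| ≠ 0 := abs_ne_zero.2 hcf
  have hL : ((((ℓ + 1 : ℕ) : ℝ)) ^ n) ≠ 0 := by positivity
  rw [h3, h1, show i.cf ^ 2 = |i.cf| ^ 2 by rw [sq_abs]]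
  field_simp

/-- ★ **`κ(a_T) = 48(d+1)·a_T`** at every member (any `c_f ≠ 0`): the prefactor `(w₋₃∕w₋₁)·c_f²·L^{−2n}` of F5's constant is `1`.
[cite: Balaban1985BackgroundPropagators, (3.69) p.404 («O(1)(Mα₀ + α₁)»), (3.41) p.397] -/
theorem kappa_eq (aT : ℝ) :
    weight (ℓ + 1) |i.cf|⁻¹ (-3) n / weight (ℓ + 1) |i.cf|⁻¹ (-1) n *
        (48 * ((d : ℝ) + 1) * i.cf ^ 2 * (((((ℓ + 1 : ℕ) : ℝ)) ^ n)⁻¹) ^ 2 * aT) = 48 * ((d : ℝ) + 1) * aT := by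
  rw [weight_ratio_eq]
  have hcf : i.cf ≠ 0 := i.hcf
  have hL : ((((ℓ + 1 : ℕ) : ℝ)) ^ n) ≠ 0 := by positivity
  field_simp

/-- ★ **`ε_Q(a_T) = (32(d+2)² + 12(d+1)²·K₁·C_τβ_τ)·a_T`** at every member (any `c_f ≠ 0`, `η ≠ 0`), `K₁ = 13344(d+1)(d+2)²(d+5)L^{d+4}`: F4's averaging
closeness constant is a MEMBER-UNIFORM multiple of `a_T` — the level weight `w_n = (Lⁿη)⁻³L^{nd}` of `Q*aQ`, the factor `(c_fη)²` and the weight ratio cancel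
all powers of `Lⁿ` and `η` exactly. [cite: Balaban1985BackgroundPropagators, (3.16)–(3.17) p.393, (3.41) p.397; Balaban1985RegularSpaces, (1.56), (1.58) p.86] -/
theorem epsQ_eq {𝔸 : Type} [CStarAlgebra 𝔸] [FiniteDimensional ℝ 𝔸] (τ : 𝔸 →ₗ[ℂ] ℂ) (Cτ : ℝ) {η : ℝ} (hη : η ≠ 0) (aT : ℝ) :
    weight (ℓ + 1) |i.cf|⁻¹ (-3) n / weight (ℓ + 1) |i.cf|⁻¹ (-1) n *
        (8 * (4 * ((d : ℝ) + 2) ^ 2 * aT) * (i.cf ^ 2 * (((((ℓ + 1 : ℕ) : ℝ)) ^ n) ^ 2)⁻¹) +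
          (i.cf * η) ^ 2 * wQ (d := d + 1) (ℓ + 1) η n *
            (2 * ((d : ℝ) + 1) * (Cτ * betaTau τ *
              (6 * ((d : ℝ) + 1) * (13344 * ((d : ℝ) + 1) * ((d : ℝ) + 2) ^ 2 * ((d : ℝ) + 5) * (((ℓ + 1 : ℕ) : ℝ)) ^ (d + 4)) * η *
                (((ℓ + 1 : ℕ) : ℝ)) ^ n * ((((ℓ + 1 : ℕ) : ℝ)) ^ n * (((((ℓ + 1 : ℕ) : ℝ)) ^ (d + 1)) ^ n)⁻¹) * aT)))) =
      (32 * ((d : ℝ) + 2) ^ 2 +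
        12 * ((d : ℝ) + 1) ^ 2 * (13344 * ((d : ℝ) + 1) * ((d : ℝ) + 2) ^ 2 * ((d : ℝ) + 5) * (((ℓ + 1 : ℕ) : ℝ)) ^ (d + 4)) * (Cτ * betaTau τ)) * aT := by
  rw [weight_ratio_eq]
  have hcf : i.cf ≠ 0 := i.hcf
  have hL : ((((ℓ + 1 : ℕ) : ℝ)) ^ n) ≠ 0 := by positivity
  have hpow : (((((ℓ + 1 : ℕ) : ℝ)) ^ (d + 1)) ^ n) = ((((ℓ + 1 : ℕ) : ℝ)) ^ n) ^ (d + 1) := by rw [← pow_mul, ← pow_mul, mul_comm]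
  unfold wQ
  rw [hpow]
  field_simp
  ring

end Arithmetic

/-! ## §2 The torus socket from the Δ_a-side members under ONE member-uniform threshold condition -/

section Matrix

open scoped Matrix Matrix.Norms.L2Operator

variable {N : ℕ} [NeZero N] (i : KIdx d ℓ hd hL b₀ b₁) {n : ℕ}

/-- ★★★ **THE TORUS SOCKET AT β = 0 FROM THE Δ_a-SIDE MEMBERS UNDER A MEMBER-UNIFORM THRESHOLD CONDITION** (`M_N(ℂ)`, `τ = tr`, `parB = parBY i`): F6's
`sockB9P3Per_torusIdx_of_deltaASide` with its numeric condition `2(κ(a_T) + 14d·M·a_T + ε_Q(a_T))B₀ ≤ 1` REPLACED by the member-uniform (n-, η-, c_f-free)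
condition `2·(48(d+1) + 14d·M + 32(d+2)² + 12(d+1)²·K₁·C_τβ_τ)·a_T·B₀ ≤ 1` (`K₁ = 13344(d+1)(d+2)²(d+5)L^{d+4}`), by §1's exact identities — so ONE threshold
`a_T` serves every member `m′ ≤ K − n` of the [B8] Thm 2 torus assembler's socket hypothesis (`B8Thm2T3FamilyBinderSockPer.hThm2_of_core_sockPer`).
[cite: Balaban1985RegularSpaces, (1.58)–(1.60) pp.86–87, Prop. 3 p.87, p.77; Balaban1985BackgroundPropagators, Thm 3.3 p.399, (3.41) p.397, (3.69) p.404, Thm 3.11 p.416] -/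
theorem sockB9P3Per_torusIdx_of_deltaASide_unif (hd2 : 2 ≤ d + 1) (hL1 : 1 ≤ ℓ + 1)
    (τ : Matrix (Fin N) (Fin N) ℂ →ₗ[ℂ] ℂ) (hτ : ∀ a, τ a = Matrix.trace a) (hτt : ∀ a b, τ (a * b) = τ (b * a))
    {Cτ : ℝ} (hCτ : ∀ x y : Matrix (Fin N) (Fin N) ℂ, |(τ (star x * y)).re| ≤ Cτ * ‖x‖ * ‖y‖)
    (hD : ∀ x, i.D.lev x = n) (hkn : i.k = n + 1) (hlev : ∀ z : SiteY i, levY i z = n) (hn : 1 ≤ n)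
    (hw : ∀ ι : IBondY i, i.w ι = i.cf ^ 2 * (((((ℓ + 1 : ℕ) : ℝ)) ^ (ι.1.1 : ℕ)) ^ (d + 1) * (1 / (((ℓ + 1 : ℕ) : ℝ)) ^ (ι.1.1 : ℕ)) ^ 2))
    (hcf : i.cf = (((ℓ + 1 : ℕ) : ℝ)) ^ (n + 1)) {η : ℝ} (hη : 0 < η) {k : ℕ} (hk : 1 ≤ k)
    (hdvd : (ℓ + 1) ^ n ∣ (PV d ℓ i.m i.K hd hL).sitesPerDir 0)
    (ops₀ : ℝ → ZdIdx (d + 1) (ℓ + 1) → ℕ →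
      (letI : CStarAlgebra (Matrix (Fin N) (Fin N) ℂ) := {}; OpsZd (d + 1) (Matrix (Fin N) (Fin N) ℂ)))
    {M : ℝ} (hM1 : 1 ≤ M) {B₀ aT : ℝ} (hB₀ : 0 < B₀) (haT : 0 < aT) (haTQ : aT ≤ alphaQ (d + 1) (ℓ + 1) / ((ℓ + 1 : ℕ) : ℝ) ^ 2)
    (haT3 : C0 (d + 1) * aT ≤ 1 / 3) (haT2 : 2 * aT ≤ c2' (d + 1) (ℓ + 1))
    (hεB : 2 * ((48 * ((d : ℝ) + 1) + 14 * d * M + (32 * ((d : ℝ) + 2) ^ 2 +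
        12 * ((d : ℝ) + 1) ^ 2 * (13344 * ((d : ℝ) + 1) * ((d : ℝ) + 2) ^ 2 * ((d : ℝ) + 5) * (((ℓ + 1 : ℕ) : ℝ)) ^ (d + 4)) *
          (Cτ * (letI : CStarAlgebra (Matrix (Fin N) (Fin N) ℂ) := {}; betaTau τ)))) * aT) * B₀ ≤ 1)
    (hΔ : letI : CStarAlgebra (Matrix (Fin N) (Fin N) ℂ) := {}
      ∀ (α₀ : ℝ) (U₀ : LSite (d + 1) → Fin (d + 1) → (Matrix (Fin N) (Fin N) ℂ)ˣ),
      (∀ x κ, U₀ x κ ∈ B7Prop2Explicit.unitaryUnits (Matrix (Fin N) (Fin N) ℂ)) →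
      IsPeriodic ((PV d ℓ i.m i.K hd hL).sitesPerDir 0) U₀ → 0 < α₀ → α₀ ≤ aT →
      InAk (ℓ + 1) n η α₀ (fun _ => (Set.univ : Set (LSite (d + 1)))) U₀ →
        IsUnit (deltaAY i (parKnitY i) (parBY i) (GpY i (parKnitY i)) (bgY i U₀)) ∧
        (∀ F, wNormBY i (-1) (GAY i (parKnitY i) (parBY i) (GpY i (parKnitY i)) (bgY i U₀) F) ≤ B₀ * wNormBY i (-3) F) ∧
        (∀ F ν, wNormBY i (-2) (cdB i (bgY i U₀) ν (GAY i (parKnitY i) (parBY i) (GpY i (parKnitY i)) (bgY i U₀) F)) ≤ B₀ * wNormBY i (-3) F) ∧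
        (∀ F, wNormBY i (-3) (lapB i (bgY i U₀) (GAY i (parKnitY i) (parBY i) (GpY i (parKnitY i)) (bgY i U₀) F)) ≤ B₀ * wNormBY i (-3) F) ∧
        IsUnit (deltaPrimeAY i (parKnitY i) (bgY i U₀)) ∧ IsUnit (XY i (parKnitY i) (GpY i (parKnitY i)) (bgY i U₀)))
    (len : LSite (d + 1) → ℝ) :
    letI : CStarAlgebra (Matrix (Fin N) (Fin N) ℂ) := {}
    SockB9P3Per (𝔸 := Matrix (Fin N) (Fin N) ℂ) ((PV d ℓ i.m i.K hd hL).sitesPerDir 0) (ℓ + 1)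
      (max 1 (2 * (2 * B₀) * max 1 (qQ (d + 1) (ℓ + 1) Cτ (betaTau τ) 0)))
      (2 * max 0 (2 * (2 * B₀)) * max 1 (qQ (d + 1) (ℓ + 1) Cτ (betaTau τ) 0))
      (min (1 / 16) (min aT (min aT (1 / (2 * (2 * B₀) * (14 * ((d + 1 - 1 : ℕ) : ℝ)) * M + 1)))))
      0 len η n (fun _ => (Set.univ : Set (LSite (d + 1)))) (fun m => torusLam (d := d + 1) m) (fun m => torusLamb (d := d + 1) m) := by
  letI : CStarAlgebra (Matrix (Fin N) (Fin N) ℂ) := {}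
  refine sockB9P3Per_torusIdx_of_deltaASide i hd2 hL1 τ hτ hτt hCτ hD hkn hlev hn hw hcf hη hk hdvd ops₀ hM1 hB₀ haT haTQ haT3 haT2 ?_ hΔ len
  rw [kappa_eq i n aT, epsQ_eq i n τ Cτ hη.ne' aT]
  convert hεB using 2
  ring

end Matrix

end Literature.MathematicalPhysics.QuantumFieldTheory.Balaban1983to89.B9B8KnitTorusSocketThreshold
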